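import Summits.QuantumFields.BalabanUV.Beta.EriceRemainderEnclosureHistoryAutonomyComparisonAgeCompositionChainWiringAtPin

/-!
# EriceRemainderEnclosureHistoryAutonomyComparisonAgeCompositionChainWiringTerms — (E80f) TRIMMING THE REMAINDER OF ROUTE (N) AT FIRST ORDER: the
# non-negativity half of MONO follows from KEY, and MONO′ (young drops of the FULL surplus) follows from MONO″ (young drops of the young solution of the old
# surplus) through the Neumann terms — **`flow_nonneg_of_mono2`: for every box solution, two monotonicities of ONE two-step object ⟹ first-order surplus ≥ 0**

Cell `pub-balaban`, β-function sub-cell, BINDER row D4 «RemainderConst leaves for Bałaban's split» (`HOME/BINDER-OWNERS.md`; owner lineage `b2b-balaban-beta-an4`;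
this file by co-owner #2 lineage `b2b-balaban-beta-d4-p2`, generation 71), β-FLOW TEAM duty (1), FREEZE (0) honoured (def-free; imports (E80e)
`…AgeCompositionChainWiringAtPin` (hence (E80d), (E80c), (E71a)–(E71d), (E75a)∕(E75b)); nothing restated).

HONEST FRAMING (page 1, verbatim and binding).  *"Discharging BetaPertH makes Bałaban's UV stability UNCONDITIONAL — a real constructive-QFT result; it is
NOT the continuum limit and NOT the Clay problem."*  THIS FILE DISCHARGES NOTHING OF THE KIND.  Elementary linear algebra about abstract triangular read∕solution
operators and real algebra over the cell's own binders `SeqBox`, `MemFlow` — hypotheses of a census, not facts; the age profile of Bałaban's (1.22) limit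
functional is NOT PRINTED ([I] p. 298; GAPS G-t4-U2-1∕-2) and NOT asserted.  Row D4 class UNCHANGED (critical-path width 0; instance 0∕1; D4 DISCHARGE NO DATE).
HONEST DEPENDENCY: continuum YM on T⁴ ⇐ BetaPertH ∧ nine spine estimates (0/9 proved); BetaPertH ⇐ (D1) ∧ (D4) ∧ CAP+tail; G-an2-4 gates asym, D1 and NE2/3/4.

THE POINT (census sense (α); route (N) of README `g62/e71`; this station `HOME/b2b-balaban-beta-d4-p2/g71/e80/README.md`).  After (E80e) `flow_nonneg_of_mono` the
first-order remainder of route (N) is MONO ∧ MONO′.  Two remarks of g62/e71 («MONO′ is implied by MONO for the terms (linearity)»; the numerics «inputs `W_i`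
non-increasing; `K_y t` non-increasing: 0 violations») become theorems here.  §1 **`antitone_young_drops`** (two-kernel letters of (E71a)): if every admissible
input's old surplus is a non-negative supersolution of the young kernel (KEY), the old reads of the young drops of its young solution are admissible (MONO), and
THE YOUNG DROPS OF THAT YOUNG SOLUTION ARE NON-INCREASING (MONO″), then the young drops of the FULL surplus are non-increasing (MONO′) — the full surplus is the
finite Neumann sum `Σ_j Sy (SO (W j))` ((E71a) `eq_sum_of_age_composition`) with admissible inputs `W j`, and reads are additive ((E71a) `read_sum`).  §2
**`nonneg_and_drop_ratio_all_ages_of_mono2`**∕**`nonneg_of_chain_closes_of_mono2`**: (E80d)'s joint induction and END with MONO asked ONLY as monotonicity (its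
non-negativity half is derived from KEY_i inside the step: (E71a) `sol_nonneg_le_of_supersol`, `read_nonneg`) and MONO′ replaced by MONO″ (§1 inside the step).
§3 **`flow_nonneg_of_mono2`**: (E80e)'s END for the flow in the same trimmed form — for every box solution, with (E71b)'s first-order operators for the flow's lone
kernels: if for every age `i` and admissible `w` the young drops `m ↦ RL i t m` of `t = SL i (SA (i+1) w)` (the young solution of the old surplus) and their old
reads `m ↦ RA (i+1) (RL i t) m` are NON-INCREASING IN THE PIN, then the first-order comparison surplus is `≥ 0`.  **THESE TWO MONOTONICITIES OF ONE TWO-STEP OBJECT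
ARE THE ENTIRE FIRST-ORDER REMAINDER OF ROUTE (N).**  NOT CLAIMED: the two monotonicities (OPEN; 0 violations numerically, g62/numerics `t7`∕`t10`∕`t15`);
anything nonlinear; anything printed.

WHAT IS PROVED ([folklore]; 0 `def`, 0 sorry).  §1 **`antitone_young_drops`**.  §2 **`nonneg_and_drop_ratio_all_ages_of_mono2`**, `nonneg_of_chain_closes_of_mono2`.
§3 **`flow_nonneg_of_mono2`**.
-/
noncomputable section
open Finset

namespace Summit.QuantumFields.BalabanUV.Beta.EriceRemainderEnclosureHistoryAutonomyComparisonAgeCompositionChainWiringTerms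

open Literature.MathematicalPhysics.QuantumFieldTheory.Balaban1983to89
open Literature.MathematicalPhysics.QuantumFieldTheory.Balaban1983to89.T4BetaStationary
open Literature.MathematicalPhysics.QuantumFieldTheory.Balaban1983to89.T4BetaFlowWellPosed
open Summit.QuantumFields.BalabanUV.Beta.EriceRemainderEnclosureHistoryAutonomyOrder (strictAnti_of_memFlow)
open Summit.QuantumFields.BalabanUV.Beta.EriceRemainderEnclosureHistoryAutonomyComparisonAgeComposition
open Summit.QuantumFields.BalabanUV.Beta.EriceRemainderEnclosureHistoryAutonomyComparisonAgeCompositionInduction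
open Summit.QuantumFields.BalabanUV.Beta.EriceRemainderEnclosureHistoryAutonomyComparisonAgeCompositionSandwich
open Summit.QuantumFields.BalabanUV.Beta.EriceRemainderEnclosureHistoryAutonomyComparisonAgeCompositionIdentification
open Summit.QuantumFields.BalabanUV.Beta.EriceRemainderEnclosureHistoryAutonomyComparisonAgeCompositionChainWiring
open Summit.QuantumFields.BalabanUV.Beta.EriceRemainderEnclosureHistoryAutonomyComparisonAgeCompositionChainWiringAtPin

/-! ## §1 MONO′ from the Neumann terms: the young drops of the full surplus are a finite sum of young drops of young solutions of old surpluses -/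

variable {N : ℕ} {KO Ky : ℕ → ℕ → ℝ} {RO Ry SO Sy : (ℕ → ℝ) → ℕ → ℝ}

/-- **MONO′ FROM MONO AND MONO″.**  Two-kernel setting of (E71a) (old `KO∕RO∕SO`, young `Ky ≥ 0∕Ry∕Sy`).  If for every non-negative non-increasing
zero-tailed input `w` the old surplus `SO w` is non-negative and a supersolution of the young kernel (KEY), the old reads of the young drops of the young
solution `RO (Ry (Sy (SO w)))` are again such an input (MONO), and THE YOUNG DROPS OF THE YOUNG SOLUTION `Ry (Sy (SO w))` ARE NON-INCREASING IN THE PIN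
(MONO″), then the young drops `Ry ε` of the FULL surplus `ε` (`ε = e − RO ε − Ry ε`, `e` such an input) are non-increasing (MONO′) — because `ε` is the
finite Neumann sum `Σ_j Sy (SO (W j))` ((E71a) `eq_sum_of_age_composition`) whose inputs `W j` all lie in the class. [folklore] -/
theorem antitone_young_drops
    (hRO : ∀ v n, RO v n = ∑ l ∈ range N, KO n l * v (n + 1 + l))
    (hRy : ∀ v n, Ry v n = ∑ l ∈ range N, Ky n l * v (n + 1 + l))
    (hSO : ∀ w : ℕ → ℝ, (∀ n, N < n → w n = 0) → (∀ n, N < n → SO w n = 0) ∧ ∀ n, SO w n = w n - RO (SO w) n)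
    (hSy : ∀ w : ℕ → ℝ, (∀ n, N < n → w n = 0) → (∀ n, N < n → Sy w n = 0) ∧ ∀ n, Sy w n = w n - Ry (Sy w) n)
    (hP : ∀ w : ℕ → ℝ, (∀ n, 0 ≤ w n) → (∀ n, w (n + 1) ≤ w n) → (∀ n, N < n → w n = 0) →
      (∀ n, 0 ≤ RO (Ry (Sy (SO w))) n) ∧ (∀ n, RO (Ry (Sy (SO w))) (n + 1) ≤ RO (Ry (Sy (SO w))) n))
    (hM2 : ∀ w : ℕ → ℝ, (∀ n, 0 ≤ w n) → (∀ n, w (n + 1) ≤ w n) → (∀ n, N < n → w n = 0) →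
      ∀ n, Ry (Sy (SO w)) (n + 1) ≤ Ry (Sy (SO w)) n)
    {e : ℕ → ℝ} (he0 : ∀ n, 0 ≤ e n) (hea : ∀ n, e (n + 1) ≤ e n) (he : ∀ n, N < n → e n = 0)
    {ε : ℕ → ℝ} (hεtail : ∀ n, N < n → ε n = 0) (hεrec : ∀ n, ε n = e n - RO ε n - Ry ε n) :
    ∀ n, Ry ε (n + 1) ≤ Ry ε n := by
  let W : ℕ → ℕ → ℝ := fun i => Nat.rec (motive := fun _ => ℕ → ℝ) e (fun _ w => RO (Ry (Sy (SO w)))) i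
  have hW0 : W 0 = e := rfl
  have hWsucc : ∀ i, W (i + 1) = RO (Ry (Sy (SO (W i)))) := fun i => rfl
  have hexp := eq_sum_of_age_composition hRO hRy hSO hSy he hW0 hWsucc hεtail hεrec
  -- every input `W i` is in the class and zero-tailed
  have hcls : ∀ i, (∀ n, 0 ≤ W i n) ∧ (∀ n, W i (n + 1) ≤ W i n) ∧ ∀ n, N < n → W i n = 0 := by
    intro i
    induction i with
    | zero => exact ⟨fun n => by rw [hW0]; exact he0 n, fun n => by rw [hW0]; exact hea n, fun n hn => by rw [hW0]; exact he n hn⟩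
    | succ i ih =>
      obtain ⟨h0, ha, hti⟩ := ih
      obtain ⟨h0', ha'⟩ := hP _ h0 ha hti
      refine ⟨fun n => by rw [hWsucc]; exact h0' n, fun n => by rw [hWsucc]; exact ha' n, fun n hn => ?_⟩
      rw [hWsucc]
      have hVt := (hSO _ hti).1
      have hTt := (hSy _ hVt).1
      have h1 := read_eq_zero_of_tail (c := 0) hRy (fun m hm => hTt m (by simpa using hm))
      exact read_eq_zero_of_tail hRO h1 n (by omega)
  -- the young read of the Neumann sum is the sum of the young reads
  have hread : ∀ n, Ry ε n = ∑ i ∈ range (N + 1), Ry (Sy (SO (W i))) n := by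
    intro n
    have hε : ε = fun m => ∑ i ∈ range (N + 1), Sy (SO (W i)) m := funext hexp
    rw [hε, read_sum hRy]
  intro n
  rw [hread, hread]
  exact sum_le_sum fun i _ => hM2 _ (hcls i).1 (hcls i).2.1 (hcls i).2.2 n

/-! ## §2 The joint induction and the END with MONO halved and MONO′ replaced by MONO″ (abstract letters) -/

section Induction

variable {n : ℕ} {KL KA : ℕ → ℕ → ℕ → ℝ} {RL RA SL SA : ℕ → (ℕ → ℝ) → ℕ → ℝ} {y : ℕ → ℕ} {θ : ℕ → ℕ → ℕ → ℝ}

/-- **THE JOINT INDUCTION, WITH MONO HALVED AND MONO′ REPLACED BY MONO″.**  (E80d) `nonneg_and_drop_ratio_all_ages` with two of its hypotheses traded for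
weaker∕more elementary ones: MONO_i is asked only as «the old reads of the young drops of the young solution of the old surplus are NON-INCREASING» (their
non-negativity FOLLOWS from KEY_i, derived inside: the young solution of a non-negative supersolution is non-negative, (E71a) `sol_nonneg_le_of_supersol`), and
MONO′_i (about the FULL surplus) is replaced by MONO″_i «the young drops `RL i (SL i (SA (i+1) w))` of the young solution of the old surplus are non-increasing»
(about the same two-step object as MONO_i) — MONO′_i then follows by §1 `antitone_young_drops`.  Same conclusion. [folklore] -/
theorem nonneg_and_drop_ratio_all_ages_of_mono2
    (hKL : ∀ i m l, 0 ≤ KL i m l) (hKLN : ∀ i m l, N ≤ l → KL i m l = 0) (hKLy : ∀ i m l, y i ≤ l → KL i m l = 0)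
    (hRL : ∀ i v m, RL i v m = ∑ l ∈ range N, KL i m l * v (m + 1 + l))
    (hRA : ∀ i v m, RA i v m = ∑ l ∈ range N, KA i m l * v (m + 1 + l))
    (hKA : ∀ i m l, KA i m l = KL i m l + KA (i + 1) m l) (hKAtop : ∀ m l, KA (n + 1) m l = 0)
    (hSL : ∀ i (w : ℕ → ℝ), (∀ m, N < m → w m = 0) → (∀ m, N < m → SL i w m = 0) ∧ ∀ m, SL i w m = w m - RL i (SL i w) m)
    (hSA : ∀ i (w : ℕ → ℝ), (∀ m, N < m → w m = 0) → (∀ m, N < m → SA i w m = 0) ∧ ∀ m, SA i w m = w m - RA i (SA i w) m)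
    (hy : ∀ i, 1 ≤ i → i ≤ n → 1 ≤ y i ∧ y i ≤ N)
    (hθ0 : ∀ k m l, 0 ≤ θ k m l) (hpers : ∀ k m l i', (1 - θ k m l) * KL k m (i' + l) ≤ KL k (m + l) i')
    (hθmono : ∀ k m l l', l ≤ l' → θ k m l ≤ θ k m l')
    {ρ : ℕ → ℕ → ℝ} {β : ℕ → ℕ → ℕ → ℝ}
    (hρ : ∀ i m, 1 ≤ i → i ≤ n → ρ i m = (∑ l ∈ range N, KL i m l) * (1 + ∑ k ∈ Ioc i n, θ k m (y i) * β (i + 1) m k) /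
      (1 - ∑ k ∈ Ioc i n, ∑ l ∈ range (y i), KL k m l))
    (hβnew : ∀ i m, 1 ≤ i → i ≤ n → β i m i = ρ i m / (1 - ρ i m))
    (hβold : ∀ i m k, 1 ≤ i → i < k → k ≤ n → β i m k = β (i + 1) m k / (1 - ρ i m))
    (hΩ1 : ∀ i m, 1 ≤ i → i ≤ n → ∑ k ∈ Ioc i n, ∑ l ∈ range (y i), KL k m l < 1)
    (hclose : ∀ i m, 1 ≤ i → i ≤ n → ρ i m < 1)
    (hMONOa : ∀ i, 1 ≤ i → i ≤ n → ∀ w : ℕ → ℝ, (∀ m, 0 ≤ w m) → (∀ m, w (m + 1) ≤ w m) → (∀ m, N < m → w m = 0) →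
      ∀ m, RA (i + 1) (RL i (SL i (SA (i + 1) w))) (m + 1) ≤ RA (i + 1) (RL i (SL i (SA (i + 1) w))) m)
    (hMONO2 : ∀ i, 1 ≤ i → i ≤ n → ∀ w : ℕ → ℝ, (∀ m, 0 ≤ w m) → (∀ m, w (m + 1) ≤ w m) → (∀ m, N < m → w m = 0) →
      ∀ m, RL i (SL i (SA (i + 1) w)) (m + 1) ≤ RL i (SL i (SA (i + 1) w)) m) :
    ∀ i, 1 ≤ i → i ≤ n + 1 →
      (∀ m k, i ≤ k → k ≤ n → 0 ≤ β i m k) ∧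
      ∀ w : ℕ → ℝ, (∀ m, 0 ≤ w m) → (∀ m, w (m + 1) ≤ w m) → (∀ m, N < m → w m = 0) →
        (∀ m, 0 ≤ SA i w m) ∧ (∀ m k, i ≤ k → k ≤ n → RL k (SA i w) m ≤ β i m k * SA i w m) := by
  suffices h : ∀ d i, i + d = n + 1 → 1 ≤ i →
      (∀ m k, i ≤ k → k ≤ n → 0 ≤ β i m k) ∧
      ∀ w : ℕ → ℝ, (∀ m, 0 ≤ w m) → (∀ m, w (m + 1) ≤ w m) → (∀ m, N < m → w m = 0) →
        (∀ m, 0 ≤ SA i w m) ∧ (∀ m k, i ≤ k → k ≤ n → RL k (SA i w) m ≤ β i m k * SA i w m) from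
    fun i hi hin => h (n + 1 - i) i (by omega) hi
  intro d
  induction d with
  | zero =>
    intro i hi _
    have : i = n + 1 := by omega
    subst this
    refine ⟨fun m k hk hkn => by omega, fun w hw0 _ hwt => ⟨fun m => ?_, fun m k hk hkn => by omega⟩⟩
    rw [aggregate_sol_top hRA hKAtop hSA hwt m]; exact hw0 m
  | succ d ih =>
    intro i hi hi1
    have hin : i ≤ n := by omega
    obtain ⟨hBN, hIH⟩ := ih (i + 1) (by omega) (by omega)
    obtain ⟨hy1, hyN⟩ := hy i hi1 hin
    -- the chain at every pin: signs
    have hx0 : ∀ m, 0 ≤ ∑ l ∈ range N, KL i m l := fun m => sum_nonneg fun l _ => hKL i m l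
    have hV0 : ∀ m, 0 ≤ ∑ k ∈ Ioc i n, θ k m (y i) * β (i + 1) m k := fun m =>
      sum_nonneg fun k hk => mul_nonneg (hθ0 k m _) (hBN m k (by have := (mem_Ioc.mp hk).1; omega) (mem_Ioc.mp hk).2)
    have hρ0 : ∀ m, 0 ≤ ρ i m := fun m => by
      rw [hρ i m hi1 hin]
      exact div_nonneg (mul_nonneg (hx0 m) (by linarith [hV0 m])) (by linarith [hΩ1 i m hi1 hin])
    have hρ1 : ∀ m, ρ i m < 1 := fun m => hclose i m hi1 hin
    -- (A) KEY_i WITH THE RATIO ρ_i(m), for every admissible input of the older system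
    have hkey : ∀ w : ℕ → ℝ, (∀ m, 0 ≤ w m) → (∀ m, w (m + 1) ≤ w m) → (∀ m, N < m → w m = 0) →
        ∀ m, RL i (SA (i + 1) w) m ≤ ρ i m * SA (i + 1) w m := by
      intro w hw0 hwa hwt m
      obtain ⟨hP, hDR⟩ := hIH w hw0 hwa hwt
      have h := (key_ratio_of_drop_ratios hKL hKLN hKLy hRL hRA hKA hKAtop hθ0 hpers hθmono hin hy1 hyN hP hwa
        (fun m' => (hSA (i + 1) w hwt).2 m') (m := m) (β := fun k => β (i + 1) m k)
        (fun k hk hkn => hDR m k (by omega) hkn) (hΩ1 i m hi1 hin)).2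
      rw [hρ i m hi1 hin]
      exact h
    have hKEY : ∀ w : ℕ → ℝ, (∀ m, 0 ≤ w m) → (∀ m, w (m + 1) ≤ w m) → (∀ m, N < m → w m = 0) →
        ∀ m, RL i (SA (i + 1) w) m ≤ SA (i + 1) w m := by
      intro w hw0 hwa hwt m
      have h1 := hkey w hw0 hwa hwt m
      have h2 := (hIH w hw0 hwa hwt).1 m
      nlinarith [hρ1 m]
    -- MONO_i in full: the non-negativity half is a CONSEQUENCE of KEY_i (young solution of a non-negative supersolution is non-negative)
    have hKA0 : ∀ m l, 0 ≤ KA (i + 1) m l := fun m l => by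
      rw [aggregate_eq_sum hKA hKAtop (by omega : i + 1 ≤ n + 1)]
      exact sum_nonneg fun k _ => hKL k m l
    have hMONO : ∀ w : ℕ → ℝ, (∀ m, 0 ≤ w m) → (∀ m, w (m + 1) ≤ w m) → (∀ m, N < m → w m = 0) →
        (∀ m, 0 ≤ RA (i + 1) (RL i (SL i (SA (i + 1) w))) m) ∧
        (∀ m, RA (i + 1) (RL i (SL i (SA (i + 1) w))) (m + 1) ≤ RA (i + 1) (RL i (SL i (SA (i + 1) w))) m) := by
      intro w hw0 hwa hwt
      have hvt := (hSA (i + 1) w hwt).1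
      have ht := sol_nonneg_le_of_supersol (hRL i) (hKL i) (hIH w hw0 hwa hwt).1 (hKEY w hw0 hwa hwt) (hSL i _ hvt).1 (hSL i _ hvt).2
      have hd0 : ∀ m, 0 ≤ RL i (SL i (SA (i + 1) w)) m := fun m => read_nonneg (hRL i) (hKL i) (fun m' _ => (ht m').1)
      exact ⟨fun m => read_nonneg (hRA (i + 1)) hKA0 (fun m' _ => hd0 m'), hMONOa i hi1 hin w hw0 hwa hwt⟩
    -- MONO′_i from MONO_i and MONO″_i through the Neumann terms
    have hMONO' : ∀ w : ℕ → ℝ, (∀ m, 0 ≤ w m) → (∀ m, w (m + 1) ≤ w m) → (∀ m, N < m → w m = 0) →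
        ∀ m, RL i (SA i w) (m + 1) ≤ RL i (SA i w) m := by
      intro w hw0 hwa hwt
      have hwrec : ∀ m, SA i w m = w m - RA (i + 1) (SA i w) m - RL i (SA i w) m := fun m => by
        rw [(hSA i w hwt).2 m, aggregate_read_succ hRL hRA hKA]; ring
      exact antitone_young_drops (RO := RA (i + 1)) (Ry := RL i) (SO := SA (i + 1)) (Sy := SL i)
        (hRA (i + 1)) (hRL i) (hSA (i + 1)) (hSL i) hMONO (hMONO2 i hi1 hin) hw0 hwa hwt (hSA i w hwt).1 hwrec
    refine ⟨?_, ?_⟩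
    · -- (D) the carried ratios stay non-negative
      intro m k hk hkn
      rcases Nat.lt_or_ge i k with hik | hik
      · rw [hβold i m k hi1 hik hkn]
        exact div_nonneg (hBN m k (by omega) hkn) (by linarith [hρ1 m])
      · have : k = i := by omega
        subst this
        rw [hβnew k m hi1 hin]
        exact div_nonneg (hρ0 m) (by linarith [hρ1 m])
    · intro e he0 hea het
      -- (B) the full system at level `i` = old (ages ≥ i+1) + young (age i); positivity and the sandwich
      have hεrec : ∀ m, SA i e m = e m - RA (i + 1) (SA i e) m - RL i (SA i e) m := fun m => by
        rw [(hSA i e het).2 m, aggregate_read_succ hRL hRA hKA]; ring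
      have hcomp := nonneg_of_age_composition_antitone (RO := RA (i + 1)) (Ry := RL i) (SO := SA (i + 1)) (Sy := SL i)
        (hRA (i + 1)) (hRL i) (hKL i) (hSA (i + 1)) (hSL i)
        (fun u hu0 hua hut => ⟨(hIH u hu0 hua hut).1, hKEY u hu0 hua hut, hMONO u hu0 hua hut⟩)
        he0 hea het (hSA i e het).1 hεrec
      have hε0 : ∀ m, 0 ≤ SA i e m := fun m => (hcomp m).1
      have hsand := surplus_sandwich (RO := RA (i + 1)) (Ry := RL i) (SO := SA (i + 1)) (Sy := SL i)
        (A := fun w => (∀ m, 0 ≤ w m) ∧ ∀ m, w (m + 1) ≤ w m)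
        (hRA (i + 1)) (hRL i) (hKL i) (hSA (i + 1)) (hSL i) het ⟨he0, hea⟩
        (fun u hu hut => ⟨(hIH u hu.1 hu.2 hut).1, hKEY u hu.1 hu.2 hut, hMONO u hu.1 hu.2 hut⟩)
        (hSA i e het).1 hεrec (ρ := ρ i) (hkey e he0 hea het)
        ⟨fun m => read_nonneg (hRL i) (hKL i) (fun m' _ => hε0 m') , hMONO' e he0 hea het⟩
      obtain ⟨_, hDRv⟩ := hIH e he0 hea het
      refine ⟨hε0, fun m k hk hkn => ?_⟩
      -- (C) transport of the drop ratios
      have hle : ∀ m', SA i e m' ≤ SA (i + 1) e m' := fun m' => (hsand m').2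
      have hlow : (1 - ρ i m) * SA (i + 1) e m ≤ SA i e m := (hsand m).1
      rcases Nat.lt_or_ge i k with hik | hik
      · -- an older age: monotonicity of its read, its ratio at level i+1, divided by 1 − ρ_i(m)
        rw [hβold i m k hi1 hik hkn]
        exact drop_ratio_step (D := fun u => RL k u m)
          (fun u u' hu0 huu' => read_le_read (hRL k) (hKL k) fun m' _ => huu' m')
          hε0 hle hlow (hρ1 m) (hBN m k (by omega) hkn) (hDRv m k (by omega) hkn)
      · -- the young age itself: its KEY ratio
        have : k = i := by omega
        subst this
        rw [hβnew k m hi1 hin]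
        exact drop_ratio_step (D := fun u => RL k u m)
          (fun u u' hu0 huu' => read_le_read (hRL k) (hKL k) fun m' _ => huu' m')
          hε0 hle hlow (hρ1 m) (hρ0 m) (hkey e he0 hea het m)


/-- **ROUTE (N), FIRST ORDER, END — MODULO MONO (halved) ∧ MONO″** (the abstract letters of (E71b)): as (E80d) `nonneg_of_chain_closes`, with the hypotheses
of `nonneg_and_drop_ratio_all_ages_of_mono2`. [folklore] -/
theorem nonneg_of_chain_closes_of_mono2
    (hKL : ∀ i m l, 0 ≤ KL i m l) (hKLN : ∀ i m l, N ≤ l → KL i m l = 0) (hKLy : ∀ i m l, y i ≤ l → KL i m l = 0)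
    (hRL : ∀ i v m, RL i v m = ∑ l ∈ range N, KL i m l * v (m + 1 + l))
    (hRA : ∀ i v m, RA i v m = ∑ l ∈ range N, KA i m l * v (m + 1 + l))
    (hKA : ∀ i m l, KA i m l = KL i m l + KA (i + 1) m l) (hKAtop : ∀ m l, KA (n + 1) m l = 0)
    (hSL : ∀ i (w : ℕ → ℝ), (∀ m, N < m → w m = 0) → (∀ m, N < m → SL i w m = 0) ∧ ∀ m, SL i w m = w m - RL i (SL i w) m)
    (hSA : ∀ i (w : ℕ → ℝ), (∀ m, N < m → w m = 0) → (∀ m, N < m → SA i w m = 0) ∧ ∀ m, SA i w m = w m - RA i (SA i w) m)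
    (hy : ∀ i, 1 ≤ i → i ≤ n → 1 ≤ y i ∧ y i ≤ N)
    (hθ0 : ∀ k m l, 0 ≤ θ k m l) (hpers : ∀ k m l i', (1 - θ k m l) * KL k m (i' + l) ≤ KL k (m + l) i')
    (hθmono : ∀ k m l l', l ≤ l' → θ k m l ≤ θ k m l')
    {ρ : ℕ → ℕ → ℝ} {β : ℕ → ℕ → ℕ → ℝ}
    (hρ : ∀ i m, 1 ≤ i → i ≤ n → ρ i m = (∑ l ∈ range N, KL i m l) * (1 + ∑ k ∈ Ioc i n, θ k m (y i) * β (i + 1) m k) /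
      (1 - ∑ k ∈ Ioc i n, ∑ l ∈ range (y i), KL k m l))
    (hβnew : ∀ i m, 1 ≤ i → i ≤ n → β i m i = ρ i m / (1 - ρ i m))
    (hβold : ∀ i m k, 1 ≤ i → i < k → k ≤ n → β i m k = β (i + 1) m k / (1 - ρ i m))
    (hΩ1 : ∀ i m, 1 ≤ i → i ≤ n → ∑ k ∈ Ioc i n, ∑ l ∈ range (y i), KL k m l < 1)
    (hclose : ∀ i m, 1 ≤ i → i ≤ n → ρ i m < 1)
    (hMONOa : ∀ i, 1 ≤ i → i ≤ n → ∀ w : ℕ → ℝ, (∀ m, 0 ≤ w m) → (∀ m, w (m + 1) ≤ w m) → (∀ m, N < m → w m = 0) →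
      ∀ m, RA (i + 1) (RL i (SL i (SA (i + 1) w))) (m + 1) ≤ RA (i + 1) (RL i (SL i (SA (i + 1) w))) m)
    (hMONO2 : ∀ i, 1 ≤ i → i ≤ n → ∀ w : ℕ → ℝ, (∀ m, 0 ≤ w m) → (∀ m, w (m + 1) ≤ w m) → (∀ m, N < m → w m = 0) →
      ∀ m, RL i (SL i (SA (i + 1) w)) (m + 1) ≤ RL i (SL i (SA (i + 1) w)) m)
    {e ε : ℕ → ℝ} (he0 : ∀ m, 0 ≤ e m) (hea : ∀ m, e (m + 1) ≤ e m) (het : ∀ m, N < m → e m = 0)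
    (hεt : ∀ m, N < m → ε m = 0) (hεrec : ∀ m, ε m = e m - RA 1 ε m) : ∀ m, 0 ≤ ε m := by
  rcases Nat.eq_zero_or_pos n with hn0 | hn0
  · -- no age at all: `RA 1 = 0`
    subst hn0
    intro m
    rw [hεrec m, hRA, sum_eq_zero fun l _ => by rw [hKAtop, zero_mul]]
    linarith [he0 m]
  have h := (nonneg_and_drop_ratio_all_ages_of_mono2 hKL hKLN hKLy hRL hRA hKA hKAtop hSL hSA hy hθ0 hpers hθmono hρ hβnew hβold hΩ1 hclose
    hMONOa hMONO2 1 le_rfl (by omega)).2 e he0 hea het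
  have heq : ∀ m, ε m = SA 1 e m := sol_unique (hRA 1) hεt hεrec (hSA 1 e het).1 (hSA 1 e het).2
  exact fun m => (heq m).symm ▸ h.1 m

end Induction

/-! ## §3 The END for the flow with MONO halved and MONO″ -/

section Flow

variable {B : (ℕ → ℝ) → ℝ} {γ b gIR : ℝ} {L : ℕ → ℝ} {K : ℕ} {h g : ℕ → ℝ} {KL θ : ℕ → ℕ → ℕ → ℝ}

/-- **ROUTE (N), FIRST ORDER, END FOR THE FLOW — MODULO MONO (halved) ∧ MONO″.**  As (E80e) `flow_nonneg_of_mono`, with MONO_i asked only as monotonicity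
and MONO′_i replaced by MONO″_i: for every box solution, if for every age `i` and every admissible input `w` the two sequences built from the YOUNG SOLUTION OF
THE OLD SURPLUS `t = SL i (SA (i+1) w)` — its young drops `m ↦ RL i t m` and their old reads `m ↦ RA (i+1) (RL i t) m` — are non-increasing in the pin, then the
first-order comparison surplus is non-negative.  These two monotonicities are now THE ENTIRE first-order remainder of route (N). [folklore] -/
theorem flow_nonneg_of_mono2 (hmono : ∀ u v : ℕ → ℝ, SeqBox γ u → SeqBox γ v → (∀ j, u j ≤ v j) → B u ≤ B v)
    (hL : ∀ k, 0 ≤ L k) (hb : 0 < b) (hlo : ∀ u, SeqBox γ u → b ≤ B u) (hdom : ∀ u, SeqBox γ u → ∑ k ∈ range K, L k * u k ≤ B u)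
    (hh : SeqBox γ h) (hf : MemFlow B gIR h)
    (hg : ∀ t, 0 < g t ∧ g t ≤ 1) (hgF : ∀ t, 1 / (1 + ∑ k ∈ range K, L k * h (t + k) ^ 3 / 2) ≤ g t) (hK : 2 ≤ K)
    (hKL : ∀ k n l, KL k n l = if 0 < k ∧ k < K ∧ l < k then L k * h (n + k) ^ 3 / 2 * ∏ t ∈ Ico (n + 1 + l) (n + k + 1), g t else 0)
    (hθ : ∀ k n l, θ k n l = 1 - (h (n + k + l) / h (n + k)) ^ 3 * ∏ t ∈ Ico (n + k + 1) (n + k + l + 1), g t)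
    {KA : ℕ → ℕ → ℕ → ℝ} {RL RA SL SA : ℕ → (ℕ → ℝ) → ℕ → ℝ}
    (hRL : ∀ i v m, RL i v m = ∑ l ∈ range K, KL i m l * v (m + 1 + l))
    (hRA : ∀ i v m, RA i v m = ∑ l ∈ range K, KA i m l * v (m + 1 + l))
    (hKA : ∀ i m l, KA i m l = KL i m l + KA (i + 1) m l) (hKAtop : ∀ m l, KA K m l = 0)
    (hSL : ∀ i (w : ℕ → ℝ), (∀ m, K < m → w m = 0) → (∀ m, K < m → SL i w m = 0) ∧ ∀ m, SL i w m = w m - RL i (SL i w) m)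
    (hSA : ∀ i (w : ℕ → ℝ), (∀ m, K < m → w m = 0) → (∀ m, K < m → SA i w m = 0) ∧ ∀ m, SA i w m = w m - RA i (SA i w) m)
    (hMONOa : ∀ i, 1 ≤ i → i ≤ K - 1 → ∀ w : ℕ → ℝ, (∀ m, 0 ≤ w m) → (∀ m, w (m + 1) ≤ w m) → (∀ m, K < m → w m = 0) →
      ∀ m, RA (i + 1) (RL i (SL i (SA (i + 1) w))) (m + 1) ≤ RA (i + 1) (RL i (SL i (SA (i + 1) w))) m)
    (hMONO2 : ∀ i, 1 ≤ i → i ≤ K - 1 → ∀ w : ℕ → ℝ, (∀ m, 0 ≤ w m) → (∀ m, w (m + 1) ≤ w m) → (∀ m, K < m → w m = 0) →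
      ∀ m, RL i (SL i (SA (i + 1) w)) (m + 1) ≤ RL i (SL i (SA (i + 1) w)) m)
    {e ε : ℕ → ℝ} (he0 : ∀ m, 0 ≤ e m) (hea : ∀ m, e (m + 1) ≤ e m) (het : ∀ m, K < m → e m = 0)
    (hεt : ∀ m, K < m → ε m = 0) (hεrec : ∀ m, ε m = e m - RA 1 ε m) : ∀ m, 0 ≤ ε m := by
  have hh0 : ∀ n, 0 < h n := fun n => (hh n).1
  have hanti := (strictAnti_of_memFlow hb hlo hh hf).antitone
  obtain ⟨ρ, β, hρ, hβnew, hβold⟩ := exists_static_chain K KL θ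
  have hac := fun n i (hi1 : 1 ≤ i) (hiK : i ≤ K - 1) =>
    age_chain_closes hmono hL hb hlo hdom hh hf hg hgF hKL hθ hρ hβnew hβold n hi1 hiK
  exact nonneg_of_chain_closes_of_mono2 (N := K) (n := K - 1) (y := fun i => i) (KL := KL) (θ := θ)
    (weight_nonneg hL hh0 hg hKL) (weight_eq_zero_of_horizon hKL)
    (fun i m l hl => by rw [hKL, if_neg (fun h3 => by omega)])
    hRL hRA hKA (fun m l => by rw [Nat.sub_add_cancel (by omega : 1 ≤ K)]; exact hKAtop m l) hSL hSA
    (fun i hi1 hiK => ⟨hi1, by omega⟩)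
    (defect_nonneg hh0 hanti hg hθ) (persistence hL hh0 hg hKL hθ) (fun k m l l' hll' => defect_mono hh0 hanti hg hθ k m hll')
    hρ hβnew hβold (fun i m hi1 hiK => (hac m i hi1 hiK).2) (fun i m hi1 hiK => (hac m i hi1 hiK).1) hMONOa hMONO2 he0 hea het hεt hεrec


end Flow

end Summit.QuantumFields.BalabanUV.Beta.EriceRemainderEnclosureHistoryAutonomyComparisonAgeCompositionChainWiringTerms

end
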